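import Literature.NumberTheory.GaloisRepresentations.PermutationLattice
import Mathlib.NumberTheory.NumberField.Units.DirichletTheorem
import HarnessLib

/-!
# Minkowski units: a Galois-permuted system of independent units (Childress Prop. 5.10, input)

Topic `NumberTheory/GaloisRepresentations` (class field theory: the units computation of
Childress, *Class Field Theory*, Ch. 4 §5 Prop. 5.10, PDF pp. 100–101, here via Artin's
"Minkowski units" instead of the lattice approximation Lemma 5.9); namespace
`Literature.NumberTheory.GaloisRepresentations.MinkowskiUnit`.  Everything **proved**.

For a finite Galois extension of number fields `E/F` with group `G`:

* `MinkowskiUnit.logVec a : InfinitePlace E → ℝ`, `w ↦ mult(w) log |a|_w`, with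
  `logVec (σ • a) w = logVec a (σ⁻¹ • w)` and `∑_w logVec a w = 0` on global units;
* **`MinkowskiUnit.exists_family`** — there are global units `u_w` (`w` an infinite place of `E`)
  with `σ • u_w = u_{σ w}` and `log |u_w|_{w'} < 0` for `w' ≠ w` (from Mathlib's
  `NumberField.Units.dirichletUnitTheorem.exists_unit`, averaged over the stabiliser of a chosen
  place above each place of `F` and transported along `G`);
* **`MinkowskiUnit.sign_of_relation`** — the "Minkowski lemma": for a real matrix with negative
  off-diagonal entries and zero row sums, every linear relation among the rows has all
  coefficients of the same strict sign (or is trivial); hence relations are unique up to scalars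
  (`relation_eq_smul`) and any relation vanishing somewhere vanishes (`relation_eq_zero`).

## References

* N. Childress, *Class Field Theory*, Universitext, Springer 2009, Ch. 4 §5 Prop. 5.10
  (PDF pp. 100–101). [Childress2009]
* J. W. S. Cassels, A. Fröhlich (eds.), *Algebraic Number Theory* (1967), Ch. VII (Tate) §8.4
  ("units: `h(U_S)`", via a `G`-permuted system of units). [CasselsFrohlichANT1967]
-/

noncomputable section

open NumberField NumberField.InfinitePlace

namespace Literature.NumberTheory.GaloisRepresentations

namespace MinkowskiUnit

variable {F : Type*} [Field F] {E : Type*} [Field E] [Algebra F E]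

/-! ### Global units inside `Eˣ` and the logarithmic vector -/

variable (E) in
/-- The global units `𝒪_Eˣ ≤ Eˣ`. [folklore] -/
def unitsE : Subgroup Eˣ := (Units.map (algebraMap (𝓞 E) E : 𝓞 E →* E)).range

/-- Membership in `unitsE`. [folklore] -/
theorem mem_unitsE_iff {a : Eˣ} : a ∈ unitsE E ↔ ∃ x : (𝓞 E)ˣ, Units.map (algebraMap (𝓞 E) E : 𝓞 E →* E) x = a :=
  Iff.rfl

/-- Values of the image of a global unit. [folklore] -/
@[simp] theorem val_unitsMap (x : (𝓞 E)ˣ) : ((Units.map (algebraMap (𝓞 E) E : 𝓞 E →* E) x : Eˣ) : E) = ((x : 𝓞 E) : E) := rfl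

/-- `unitsE` is `Gal(E/F)`-stable. [cite: CasselsFrohlichANT1967, Ch. VII §1.1] -/
theorem smul_mem_unitsE (σ : E ≃ₐ[F] E) {a : Eˣ} (ha : a ∈ unitsE E) : σ • a ∈ unitsE E := by
  obtain ⟨x, rfl⟩ := ha
  exact ⟨Units.map (MulSemiringAction.toRingHom (E ≃ₐ[F] E) (𝓞 E) σ).toMonoidHom x, Units.ext rfl⟩

/-- `unitsE` is stable in the sense of the Herbrand calculus. [folklore] -/
theorem isStable_unitsE : Herbrand.IsStable (E ≃ₐ[F] E) (unitsE E) := fun σ _ ha => smul_mem_unitsE σ ha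

/-- The value in `E` of `σ • a` for `a ∈ Eˣ`. [folklore] -/
theorem val_smul (σ : E ≃ₐ[F] E) (a : Eˣ) : ((σ • a : Eˣ) : E) = σ (a : E) := rfl

/-- **The logarithmic vector** `a ↦ (mult(w) · log |a|_w)_w` on `Eˣ` (all infinite places,
Childress's `ψ_{S_∞}` with multiplicities). [cite: Childress2009, Ch. 4 §5 before Prop. 5.10 (PDF p. 100)] -/
def logVec (a : Eˣ) (w : InfinitePlace E) : ℝ := (mult w : ℝ) * Real.log (w (a : E))

/-- `logVec (a b) = logVec a + logVec b`. [folklore] -/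
theorem logVec_mul (a b : Eˣ) (w : InfinitePlace E) : logVec (a * b) w = logVec a w + logVec b w := by
  rw [logVec, logVec, logVec, Units.val_mul, map_mul, Real.log_mul, mul_add]
  · exact (map_ne_zero w).mpr a.ne_zero
  · exact (map_ne_zero w).mpr b.ne_zero

/-- `logVec 1 = 0`. [folklore] -/
theorem logVec_one (w : InfinitePlace E) : logVec (1 : Eˣ) w = 0 := by
  rw [logVec, Units.val_one, map_one, Real.log_one, mul_zero]

/-- `logVec a⁻¹ = -logVec a`. [folklore] -/
theorem logVec_inv (a : Eˣ) (w : InfinitePlace E) : logVec a⁻¹ w = -logVec a w := by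
  have h := logVec_mul a a⁻¹ w
  rw [mul_inv_cancel, logVec_one] at h
  linarith

/-- `logVec (∏ aᵢ) = ∑ logVec aᵢ`. [folklore] -/
theorem logVec_prod {ι : Type*} (s : Finset ι) (a : ι → Eˣ) (w : InfinitePlace E) :
    logVec (∏ i ∈ s, a i) w = ∑ i ∈ s, logVec (a i) w := by
  classical
  induction s using Finset.induction_on with
  | empty => rw [Finset.prod_empty, Finset.sum_empty, logVec_one]
  | insert i s hi ih => rw [Finset.prod_insert hi, Finset.sum_insert hi, logVec_mul, ih]

/-- `logVec (a ^ k) = k • logVec a`. [folklore] -/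
theorem logVec_zpow (a : Eˣ) (k : ℤ) (w : InfinitePlace E) : logVec (a ^ k) w = k * logVec a w := by
  have hnat : ∀ n : ℕ, logVec (a ^ n) w = n * logVec a w := fun n => by
    induction n with
    | zero => rw [pow_zero, logVec_one, Nat.cast_zero, zero_mul]
    | succ n ih => rw [pow_succ, logVec_mul, ih]; push_cast; ring
  rcases k with k | k
  · rw [Int.ofNat_eq_natCast, zpow_natCast, hnat]; push_cast; ring
  · rw [zpow_negSucc, logVec_inv, hnat, Int.negSucc_eq]; push_cast; ring

/-- `mult` is invariant under the Galois action on places. [folklore] -/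
theorem mult_smul (σ : E ≃ₐ[F] E) (w : InfinitePlace E) : mult (σ • w) = mult w := by
  simp only [mult]
  rw [InfinitePlace.isReal_smul_iff (σ := σ) (w := w)]

/-- **Equivariance**: `logVec (σ • a) w = logVec a (σ⁻¹ • w)` (`|σ a|_w = |a|_{σ⁻¹ w}`).
[cite: CasselsFrohlichANT1967, Ch. VII §1.1] -/
theorem logVec_smul (σ : E ≃ₐ[F] E) (a : Eˣ) (w : InfinitePlace E) :
    logVec (σ • a) w = logVec a (σ⁻¹ • w) := by
  rw [logVec, logVec, mult_smul, val_smul, InfinitePlace.smul_apply]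
  rfl

/-- **Product formula** on global units: `∑_w logVec a w = 0`. [folklore] -/
theorem sum_logVec_eq_zero [NumberField E] {a : Eˣ} (ha : a ∈ unitsE E) : ∑ w, logVec a w = 0 := by
  obtain ⟨x, rfl⟩ := ha
  exact NumberField.Units.sum_mult_mul_log x

/-! ### The Minkowski lemma: relations among rows with negative off-diagonal entries -/

section Sign

variable {X : Type*} [Fintype X] [DecidableEq X] {M : X → X → ℝ}

/-- Rows with negative off-diagonal entries and zero sums: in any linear relation among the rows,
the set of positive coefficients is empty or everything. [folklore] -/
theorem setOf_pos_eq_of_relation (hoff : ∀ w w', w ≠ w' → M w w' < 0) (hrow : ∀ w, ∑ w', M w w' = 0)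
    {c : X → ℝ} (hc : ∀ w', ∑ w, c w * M w w' = 0) :
    (∀ w, 0 < c w) ∨ ∀ w, c w ≤ 0 := by
  by_contra h
  rw [not_or, not_forall, not_forall] at h
  obtain ⟨⟨w₂, hw₂⟩, ⟨w₁, hw₁⟩⟩ := h
  rw [not_lt] at hw₂; rw [not_le] at hw₁
  -- `S` = positive coefficients, nonempty (w₁) and not everything (w₂)
  set S : Finset X := Finset.univ.filter fun w => 0 < c w with hS
  have hw₁S : w₁ ∈ S := by rw [hS, Finset.mem_filter]; exact ⟨Finset.mem_univ _, hw₁⟩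
  have hw₂S : w₂ ∉ S := by rw [hS, Finset.mem_filter, not_and, not_lt]; exact fun _ => hw₂
  set R : X → ℝ := fun w => ∑ w' ∈ Sᶜ, M w w' with hR
  -- the total `T = ∑_{w' ∉ S} (∑_w c_w M_{w w'}) = 0`
  have hT : ∑ w, c w * R w = 0 := by
    have : ∑ w' ∈ Sᶜ, ∑ w, c w * M w w' = 0 := Finset.sum_eq_zero fun w' _ => hc w'
    rw [Finset.sum_comm] at this
    simpa only [hR, Finset.mul_sum] using this
  -- signs of the summands
  have hneg : ∀ w ∈ S, c w * R w < 0 := by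
    intro w hw
    have hcw : 0 < c w := (Finset.mem_filter.mp hw).2
    have hRw : R w < 0 := by
      apply Finset.sum_neg
      · intro w' hw'
        exact hoff w w' (by rintro rfl; exact (Finset.mem_compl.mp hw') hw)
      · exact ⟨w₂, Finset.mem_compl.mpr hw₂S⟩
    exact mul_neg_of_pos_of_neg hcw hRw
  have hnonpos : ∀ w ∉ S, c w * R w ≤ 0 := by
    intro w hw
    have hcw : c w ≤ 0 := by
      by_contra h'; exact hw (Finset.mem_filter.mpr ⟨Finset.mem_univ _, lt_of_not_ge h'⟩)
    have hRw : 0 ≤ R w := by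
      have hsplit := Finset.sum_add_sum_compl S (M w)
      rw [hrow w] at hsplit
      have : ∑ w' ∈ S, M w w' < 0 := by
        apply Finset.sum_neg
        · intro w' hw'; exact hoff w w' (by rintro rfl; exact hw hw')
        · exact ⟨w₁, hw₁S⟩
      show 0 ≤ ∑ w' ∈ Sᶜ, M w w'
      linarith
    exact mul_nonpos_of_nonpos_of_nonneg hcw hRw
  -- contradiction: the total is negative
  have hlt : ∑ w, c w * R w < 0 := by
    rw [← Finset.add_sum_erase _ _ (Finset.mem_univ w₁)]
    have h1 := hneg w₁ hw₁S
    have h2 : ∑ w ∈ Finset.univ.erase w₁, c w * R w ≤ 0 :=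
      Finset.sum_nonpos fun w _ => by
        by_cases hw : w ∈ S
        · exact (hneg w hw).le
        · exact hnonpos w hw
    linarith
  exact hlt.ne hT

/-- **Minkowski's lemma.**  For a real square matrix with negative off-diagonal entries and zero
row sums, the coefficients of a linear relation among the rows are all positive, all negative, or
all zero. [cite: Childress2009, Ch. 4 §5 Lemma 5.8 (cf.) (PDF p. 100)] -/
theorem sign_of_relation (hoff : ∀ w w', w ≠ w' → M w w' < 0) (hrow : ∀ w, ∑ w', M w w' = 0)
    {c : X → ℝ} (hc : ∀ w', ∑ w, c w * M w w' = 0) :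
    (∀ w, 0 < c w) ∨ (∀ w, c w < 0) ∨ ∀ w, c w = 0 := by
  rcases setOf_pos_eq_of_relation hoff hrow hc with h | h
  · exact Or.inl h
  · have hc' : ∀ w', ∑ w, (-c w) * M w w' = 0 := fun w' => by
      simp only [neg_mul, Finset.sum_neg_distrib, hc w', neg_zero]
    rcases setOf_pos_eq_of_relation hoff hrow hc' with h' | h'
    · exact Or.inr (Or.inl fun w => by linarith [h' w])
    · exact Or.inr (Or.inr fun w => le_antisymm (h w) (by linarith [h' w]))

/-- A relation vanishing at one place vanishes. [folklore] -/
theorem relation_eq_zero (hoff : ∀ w w', w ≠ w' → M w w' < 0) (hrow : ∀ w, ∑ w', M w w' = 0)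
    {c : X → ℝ} (hc : ∀ w', ∑ w, c w * M w w' = 0) {w₀ : X} (h0 : c w₀ = 0) : c = 0 := by
  rcases sign_of_relation hoff hrow hc with h | h | h
  · exact absurd h0 (h w₀).ne'
  · exact absurd h0 (h w₀).ne
  · exact funext h

/-- **Relations are unique up to scalars.** [folklore] -/
theorem relation_eq_smul (hoff : ∀ w w', w ≠ w' → M w w' < 0) (hrow : ∀ w, ∑ w', M w w' = 0)
    {c c' : X → ℝ} (hc : ∀ w', ∑ w, c w * M w w' = 0) (hc' : ∀ w', ∑ w, c' w * M w w' = 0)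
    (w₀ : X) (h0 : c' w₀ ≠ 0) : c = (c w₀ / c' w₀) • c' := by
  have hd : ∀ w', ∑ w, (c - (c w₀ / c' w₀) • c') w * M w w' = 0 := fun w' => by
    simp only [Pi.sub_apply, Pi.smul_apply, smul_eq_mul, sub_mul, Finset.sum_sub_distrib, hc w',
      mul_assoc, ← Finset.mul_sum, hc' w', mul_zero, sub_zero]
  have := relation_eq_zero hoff hrow hd (w₀ := w₀) (by simp [div_mul_cancel₀ _ h0])
  exact sub_eq_zero.mp this

end Sign

/-! ### The Galois-permuted family of Minkowski units -/

section Family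

open Literature.NumberTheory.Automorphic

/-- `|σ • a|_{w'} = |a|_{σ⁻¹ w'}`. [cite: CasselsFrohlichANT1967, Ch. VII §1.1] -/
theorem apply_val_smul (σ : E ≃ₐ[F] E) (a : Eˣ) (w' : InfinitePlace E) :
    w' ((σ • a : Eˣ) : E) = (σ⁻¹ • w') (a : E) := by
  rw [val_smul, InfinitePlace.smul_apply]
  rfl

variable [NumberField F] [NumberField E] [IsGalois F E]

/-- **Minkowski units.**  For `E/F` Galois there are global units `u_w ∈ 𝒪_Eˣ`, one for each
infinite place `w` of `E`, permuted by the Galois group (`σ • u_w = u_{σ w}`) and with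
`log |u_w|_{w'} < 0` for all `w' ≠ w` (Artin's units: a unit small at all places but `w_v`,
averaged over the decomposition group of a chosen `w_v ∣ v` and transported along `G`).
[cite: CasselsFrohlichANT1967, Ch. VII §8.4; Childress2009, Ch. 4 §5 Prop. 5.10 (PDF pp. 100–101)] -/
theorem exists_family :
    ∃ u : InfinitePlace E → Eˣ, (∀ w, u w ∈ unitsE E) ∧
      (∀ (σ : E ≃ₐ[F] E) (w : InfinitePlace E), σ • u w = u (σ • w)) ∧
      ∀ w w' : InfinitePlace E, w' ≠ w → Real.log (w' (u w : E)) < 0 := by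
  classical
  haveI : FiniteDimensional F E := Module.Finite.of_restrictScalars_finite ℚ F E
  set G := E ≃ₐ[F] E
  -- a chosen place above each place of `F`, and a unit small away from it
  set wv : InfinitePlace F → InfinitePlace E := ArchHerbrand.placeOver E with hwv
  have hε : ∀ v : InfinitePlace F, ∃ ε : (𝓞 E)ˣ, ∀ w : InfinitePlace E, w ≠ wv v → Real.log (w ε) < 0 :=
    fun v => NumberField.Units.dirichletUnitTheorem.exists_unit E (wv v)
  choose ε hε using hε
  set εE : InfinitePlace F → Eˣ := fun v => Units.map (algebraMap (𝓞 E) E : 𝓞 E →* E) (ε v) with hεE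
  have hεEval : ∀ v (w : InfinitePlace E), w ((εE v : Eˣ) : E) = w (ε v) := fun v w => rfl
  -- average over the stabiliser
  set η : InfinitePlace F → Eˣ := fun v =>
    ∏ τ ∈ (MulAction.stabilizer G (wv v) : Set G).toFinset, τ • εE v with hη
  have hηmem : ∀ v, η v ∈ unitsE E := fun v =>
    Subgroup.prod_mem _ fun τ _ => smul_mem_unitsE τ ⟨ε v, rfl⟩
  have hηfix : ∀ v (τ₀ : G), τ₀ • wv v = wv v → τ₀ • η v = η v := by
    intro v τ₀ hτ₀
    simp only [hη, Finset.smul_prod', smul_smul]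
    refine Finset.prod_bij' (fun τ _ => τ₀ * τ) (fun τ _ => τ₀⁻¹ * τ) ?_ ?_ ?_ ?_ ?_
    · intro τ hτ
      rw [Set.mem_toFinset] at hτ ⊢
      exact (MulAction.stabilizer G (wv v)).mul_mem hτ₀ hτ
    · intro τ hτ
      rw [Set.mem_toFinset] at hτ ⊢
      exact (MulAction.stabilizer G (wv v)).mul_mem ((MulAction.stabilizer G (wv v)).inv_mem hτ₀) hτ
    · intro τ _; simp
    · intro τ _; simp
    · intro τ _; rfl
  have hηlog : ∀ v (w' : InfinitePlace E), w' ≠ wv v → Real.log (w' (η v : E)) < 0 := by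
    intro v w' hw'
    simp only [hη, Units.coe_prod, map_prod]
    rw [Real.log_prod]
    · apply Finset.sum_neg
      · intro τ hτ
        rw [Set.mem_toFinset] at hτ
        rw [apply_val_smul, hεEval]
        refine hε v _ fun h => hw' ?_
        have : τ • (τ⁻¹ • w') = τ • wv v := by rw [h]
        rwa [smul_inv_smul, show τ • wv v = wv v from hτ] at this
      · exact ⟨1, by rw [Set.mem_toFinset]; exact (MulAction.stabilizer G (wv v)).one_mem⟩
    · intro τ _; exact (map_ne_zero _).mpr (Units.ne_zero _)
  -- transport along `G`
  have hg : ∀ w : InfinitePlace E, ∃ g : G, g • wv (w.comap (algebraMap F E)) = w := fun w =>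
    ArchHerbrand.exists_smul_eq_of_isOver (ArchHerbrand.isOver_placeOver _) (rfl : ArchHerbrand.IsOver E _ w)
  choose g hg using hg
  refine ⟨fun w => g w • η (w.comap (algebraMap F E)), fun w => smul_mem_unitsE _ (hηmem _), fun σ w => ?_,
    fun w w' hw' => ?_⟩
  · -- equivariance
    set v := w.comap (algebraMap F E) with hvdef
    have hv : (σ • w).comap (algebraMap F E) = v := InfinitePlace.comap_algEquiv_smul F σ w
    show σ • (g w • η v) = g (σ • w) • η ((σ • w).comap (algebraMap F E))
    rw [hv]
    have h1 : g w • wv v = w := hg w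
    have h2 := hg (σ • w)
    rw [hv] at h2
    -- `(g w)⁻¹ σ⁻¹ g(σw)` stabilises `wv v`
    have hstab : ((g w)⁻¹ * σ⁻¹ * g (σ • w)) • wv v = wv v := by
      rw [mul_smul, mul_smul, h2, inv_smul_smul, inv_smul_eq_iff, h1]
    calc σ • (g w • η v) = (σ * g w) • η v := smul_smul _ _ _
      _ = (σ * g w) • (((g w)⁻¹ * σ⁻¹ * g (σ • w)) • η v) := by rw [hηfix v _ hstab]
      _ = g (σ • w) • η v := by rw [smul_smul]; congr 1; group
  · -- smallness away from `w`
    show Real.log (w' ((g w • η (w.comap (algebraMap F E)) : Eˣ) : E)) < 0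
    rw [apply_val_smul]
    refine hηlog _ _ fun h => hw' ?_
    have : g w • ((g w)⁻¹ • w') = g w • wv (w.comap (algebraMap F E)) := by rw [h]
    rwa [smul_inv_smul, hg w] at this

end Family

/-! ### The realisation `ℤ[S_∞] → 𝒪_Eˣ` of a Minkowski family and its relation lattice -/

section Realisation

open PermLattice PermLattice.PermMod

variable [NumberField E]
variable (u : InfinitePlace E → Eˣ)

/-- **The realisation map** `ℤ[S_∞(E)] →* Eˣ`, `f ↦ ∏_w u_w^{f(w)}`. [cite: CasselsFrohlichANT1967, Ch. VII §8.4] -/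
def real : PermMod (InfinitePlace E) →* Eˣ where
  toFun f := ∏ w, u w ^ f.val w
  map_one' := by simp
  map_mul' f g := by
    rw [← Finset.prod_mul_distrib]
    exact Finset.prod_congr rfl fun w _ => by rw [val_mul, zpow_add]

/-- `real f = ∏_w u_w^{f w}`. [folklore] -/
theorem real_apply (f : PermMod (InfinitePlace E)) : real u f = ∏ w, u w ^ f.val w := rfl

/-- `real (e_w) = u_w`. [folklore] -/
theorem real_single [DecidableEq (InfinitePlace E)] (w : InfinitePlace E) : real u (single w) = u w := by
  classical
  rw [real_apply, Finset.prod_eq_single w]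
  · rw [val_single, if_pos rfl, zpow_one]
  · intro w' _ hne; rw [val_single, if_neg hne, zpow_zero]
  · intro h; exact absurd (Finset.mem_univ w) h

/-- `logVec (real f) = ∑_w f(w) logVec u_w`. [folklore] -/
theorem logVec_real (f : PermMod (InfinitePlace E)) (w' : InfinitePlace E) :
    logVec (real u f) w' = ∑ w, (f.val w : ℝ) * logVec (u w) w' := by
  rw [real_apply, logVec_prod]
  exact Finset.sum_congr rfl fun w _ => logVec_zpow _ _ _

variable {u}

/-- The realisation of a `G`-permuted family is `G`-equivariant. [folklore] -/
theorem real_smul (hu : ∀ (σ : E ≃ₐ[F] E) (w : InfinitePlace E), σ • u w = u (σ • w))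
    (σ : E ≃ₐ[F] E) (f : PermMod (InfinitePlace E)) : real u (σ • f) = σ • real u f := by
  rw [real_apply, real_apply, Finset.smul_prod']
  simp_rw [smul_zpow', hu, PermMod.val_smul]
  exact Fintype.prod_equiv (MulAction.toPerm σ⁻¹) _ _ fun w => by
    simp [MulAction.toPerm_apply, smul_inv_smul]

/-- The realisation of global units is a global unit. [folklore] -/
theorem real_mem_unitsE (hu : ∀ w, u w ∈ unitsE E) (f : PermMod (InfinitePlace E)) : real u f ∈ unitsE E :=
  Subgroup.prod_mem _ fun w _ => Subgroup.zpow_mem _ (hu w) _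

variable (E) in
/-- **The "torsion"** `T = {a ∈ 𝒪_Eˣ : log |a|_w = 0 ∀ w}` (the roots of unity of `E`).
[cite: Childress2009, Ch. 4 §5 Prop. 5.10 (proof) (PDF p. 101)] -/
def torsionE : Subgroup Eˣ where
  carrier := {a | a ∈ unitsE E ∧ ∀ w, logVec a w = 0}
  one_mem' := ⟨Subgroup.one_mem _, logVec_one⟩
  mul_mem' := fun {a b} ha hb => ⟨Subgroup.mul_mem _ ha.1 hb.1, fun w => by rw [logVec_mul, ha.2, hb.2, add_zero]⟩
  inv_mem' := fun {a} ha => ⟨Subgroup.inv_mem _ ha.1, fun w => by rw [logVec_inv, ha.2, neg_zero]⟩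

omit [NumberField E] in
/-- Membership in `torsionE`. [folklore] -/
theorem mem_torsionE_iff {a : Eˣ} : a ∈ torsionE E ↔ a ∈ unitsE E ∧ ∀ w, logVec a w = 0 := Iff.rfl

omit [NumberField E] in
/-- `torsionE ≤ unitsE`. [folklore] -/
theorem torsionE_le_unitsE : torsionE E ≤ unitsE E := fun _ ha => ha.1

/-- `torsionE` is the image of Mathlib's torsion subgroup of `𝒪_Eˣ`. [folklore] -/
theorem mem_torsionE_iff_exists {a : Eˣ} :
    a ∈ torsionE E ↔ ∃ x ∈ NumberField.Units.torsion E, Units.map (algebraMap (𝓞 E) E : 𝓞 E →* E) x = a := by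
  constructor
  · rintro ⟨⟨x, rfl⟩, hlog⟩
    refine ⟨x, (NumberField.Units.mem_torsion E).mpr fun w => ?_, rfl⟩
    have h := hlog w
    rw [logVec, mul_eq_zero] at h
    rcases h with h | h
    · exact absurd (by exact_mod_cast h) (mult_ne_zero (w := w))
    · have hpos : 0 < w ((Units.map (algebraMap (𝓞 E) E : 𝓞 E →* E) x : Eˣ) : E) :=
        InfinitePlace.pos_iff.mpr (Units.ne_zero _)
      exact Real.eq_one_of_pos_of_log_eq_zero hpos h
  · rintro ⟨x, hx, rfl⟩
    refine ⟨⟨x, rfl⟩, fun w => ?_⟩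
    rw [logVec, val_unitsMap, (NumberField.Units.mem_torsion E).mp hx w, Real.log_one, mul_zero]

/-- `torsionE` is finite. [folklore] -/
instance finite_torsionE : Finite (torsionE E) := by
  have hsurj : Function.Surjective (fun x : NumberField.Units.torsion E =>
      (⟨Units.map (algebraMap (𝓞 E) E : 𝓞 E →* E) x, mem_torsionE_iff_exists.mpr ⟨x, x.2, rfl⟩⟩ : torsionE E)) := by
    rintro ⟨a, ha⟩
    obtain ⟨x, hx, rfl⟩ := mem_torsionE_iff_exists.mp ha
    exact ⟨⟨x, hx⟩, rfl⟩
  exact Finite.of_surjective _ hsurj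

omit [NumberField E] in
/-- `torsionE` is `Gal(E/F)`-stable. [folklore] -/
theorem isStable_torsionE : Herbrand.IsStable (E ≃ₐ[F] E) (torsionE E) := fun σ a ha =>
  ⟨smul_mem_unitsE σ ha.1, fun w => by rw [logVec_smul, ha.2]⟩

variable (u) in
/-- **The relation lattice** `K = {f ∈ ℤ[S_∞] : ∏ u_w^{f w} is a root of unity}`.
[cite: Childress2009, Ch. 4 §5 Prop. 5.10 (proof) (PDF p. 101)] -/
def relLattice : Subgroup (PermMod (InfinitePlace E)) := (torsionE E).comap (real u)

/-- Membership in the relation lattice: a linear relation among the `logVec u_w`. [folklore] -/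
theorem mem_relLattice_iff (hu : ∀ w, u w ∈ unitsE E) {f : PermMod (InfinitePlace E)} :
    f ∈ relLattice u ↔ ∀ w', ∑ w, (f.val w : ℝ) * logVec (u w) w' = 0 := by
  rw [relLattice, Subgroup.mem_comap, mem_torsionE_iff]
  simp only [real_mem_unitsE hu, true_and, logVec_real]

/-- The relation lattice is `Gal(E/F)`-stable. [folklore] -/
theorem isStable_relLattice (hu : ∀ (σ : E ≃ₐ[F] E) (w : InfinitePlace E), σ • u w = u (σ • w)) :
    Herbrand.IsStable (E ≃ₐ[F] E) (relLattice u) := by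
  intro σ f hf
  rw [relLattice, Subgroup.mem_comap, real_smul hu]
  exact isStable_torsionE σ hf

/-! ### Structure of the relation lattice of a Minkowski family -/

variable (hu₁ : ∀ w, u w ∈ unitsE E)
  (hu₂ : ∀ (σ : E ≃ₐ[F] E) (w : InfinitePlace E), σ • u w = u (σ • w))
  (hu₃ : ∀ w w' : InfinitePlace E, w' ≠ w → Real.log (w' (u w : E)) < 0)
include hu₁ hu₃

omit [NumberField E] hu₁ in
/-- The log matrix of a Minkowski family has negative off-diagonal entries. [folklore] -/
theorem logVec_neg {w w' : InfinitePlace E} (h : w ≠ w') : logVec (u w) w' < 0 :=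
  mul_neg_of_pos_of_neg (by exact_mod_cast mult_pos) (hu₃ w w' (Ne.symm h))

/-- A relation vanishing at one place is trivial. [folklore] -/
theorem eq_one_of_mem_relLattice_of_val_eq_zero {f : PermMod (InfinitePlace E)} (hf : f ∈ relLattice u)
    {w₀ : InfinitePlace E} (h0 : f.val w₀ = 0) : f = 1 := by
  classical
  have hrel := (mem_relLattice_iff hu₁).mp hf
  have := relation_eq_zero (M := fun w w' => logVec (u w) w') (fun w w' h => logVec_neg hu₃ h)
    (fun w => sum_logVec_eq_zero (hu₁ w)) hrel (w₀ := w₀) (by exact_mod_cast h0)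
  ext w
  have hw := congrFun this w
  simp only [Pi.zero_apply, Int.cast_eq_zero] at hw
  rw [hw, val_one]

omit hu₁ hu₃ in
/-- The sum of the coordinates is invariant under the action. [folklore] -/
theorem sum_val_smul (σ : E ≃ₐ[F] E) (f : PermMod (InfinitePlace E)) : ∑ w, (σ • f).val w = ∑ w, f.val w :=
  Fintype.sum_equiv (MulAction.toPerm σ⁻¹) _ _ fun w => by simp [MulAction.toPerm_apply]

include hu₂ in
/-- **`Gal(E/F)` acts trivially on the relation lattice** (a relation has all coefficients of one
sign, and `σ • f`, `f` are proportional relations with the same coefficient sum).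
[cite: Childress2009, Ch. 4 §5 Prop. 5.10 (proof) (PDF p. 101)] -/
theorem smul_eq_of_mem_relLattice (σ : E ≃ₐ[F] E) {f : PermMod (InfinitePlace E)} (hf : f ∈ relLattice u) :
    σ • f = f := by
  classical
  by_cases h1 : f = 1
  · rw [h1, smul_one]
  · -- `f` has a non-zero (hence everywhere non-zero) coordinate
    obtain ⟨w₀, hw₀⟩ : ∃ w₀, f.val w₀ ≠ 0 := by
      by_contra h
      simp only [not_exists, not_not] at h
      exact h1 (PermMod.ext fun w => by rw [h w, val_one])
    set M : InfinitePlace E → InfinitePlace E → ℝ := fun w w' => logVec (u w) w'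
    have hoff : ∀ w w', w ≠ w' → M w w' < 0 := fun w w' h => logVec_neg hu₃ h
    have hrow : ∀ w, ∑ w', M w w' = 0 := fun w => sum_logVec_eq_zero (hu₁ w)
    have hc : ∀ w', ∑ w, (f.val w : ℝ) * M w w' = 0 := (mem_relLattice_iff hu₁).mp hf
    have hc' : ∀ w', ∑ w, ((σ • f).val w : ℝ) * M w w' = 0 :=
      (mem_relLattice_iff hu₁).mp (isStable_relLattice hu₂ σ hf)
    have hprop := relation_eq_smul (c := fun w => ((σ • f).val w : ℝ)) (c' := fun w => (f.val w : ℝ))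
      hoff hrow hc' hc w₀ (by exact_mod_cast hw₀)
    -- compare coefficient sums
    set t : ℝ := ((σ • f).val w₀ : ℝ) / (f.val w₀ : ℝ) with ht
    have hsum : ∑ w, ((σ • f).val w : ℝ) = t * ∑ w, (f.val w : ℝ) := by
      rw [Finset.mul_sum]
      exact Finset.sum_congr rfl fun w _ => by
        have := congrFun hprop w; simpa only [Pi.smul_apply, smul_eq_mul] using this
    have hsum' : ∑ w, ((σ • f).val w : ℝ) = ∑ w, (f.val w : ℝ) := by
      have := sum_val_smul σ f
      exact_mod_cast this
    have hne : ∑ w, (f.val w : ℝ) ≠ 0 := by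
      rcases sign_of_relation (c := fun w => (f.val w : ℝ)) hoff hrow hc with h | h | h
      · exact (Finset.sum_pos (fun w _ => h w) Finset.univ_nonempty).ne'
      · exact (Finset.sum_neg (fun w _ => h w) Finset.univ_nonempty).ne
      · exact absurd (by exact_mod_cast h w₀) hw₀
    have ht1 : t = 1 := by
      have : t * ∑ w, (f.val w : ℝ) = 1 * ∑ w, (f.val w : ℝ) := by rw [← hsum, hsum', one_mul]
      exact mul_right_cancel₀ hne this
    ext w
    have := congrFun hprop w
    simp only [Pi.smul_apply, smul_eq_mul] at this
    rw [ht1, one_mul] at this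
    exact_mod_cast this

/-- **The relation lattice is cyclic**: generated by an element with minimal non-zero
coordinate at a fixed place (division with remainder; a relation vanishing somewhere vanishes).
[folklore] -/
theorem exists_relLattice_eq_zpowers (hK : relLattice u ≠ ⊥) :
    ∃ f₀ : PermMod (InfinitePlace E), f₀ ≠ 1 ∧ relLattice u = Subgroup.zpowers f₀ := by
  classical
  obtain ⟨w₀⟩ := (inferInstance : Nonempty (InfinitePlace E))
  -- non-trivial elements have non-zero coordinate at `w₀`
  have hnz : ∀ f ∈ relLattice u, f ≠ 1 → f.val w₀ ≠ 0 := fun f hf hne h0 =>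
    hne (eq_one_of_mem_relLattice_of_val_eq_zero hu₁ hu₃ hf h0)
  have hex : ∃ n : ℕ, ∃ f ∈ relLattice u, f ≠ 1 ∧ (f.val w₀).natAbs = n := by
    obtain ⟨⟨f, hf⟩, hne⟩ := (Subgroup.ne_bot_iff_exists_ne_one.mp hK)
    exact ⟨_, f, hf, fun h => hne (Subtype.ext h), rfl⟩
  obtain ⟨f₀, hf₀, hne₀, hmin⟩ := Nat.find_spec hex
  have hminimal : ∀ f ∈ relLattice u, f ≠ 1 → (f₀.val w₀).natAbs ≤ (f.val w₀).natAbs := fun f hf hne => by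
    rw [hmin]; exact Nat.find_min' hex ⟨f, hf, hne, rfl⟩
  refine ⟨f₀, hne₀, le_antisymm (fun f hf => ?_) ((Subgroup.zpowers_le).mpr hf₀)⟩
  -- division with remainder at `w₀`
  set a := f₀.val w₀ with ha
  have ha0 : a ≠ 0 := hnz f₀ hf₀ hne₀
  set q := f.val w₀ / a with hq
  set g := f / f₀ ^ q with hg
  have hgmem : g ∈ relLattice u := Subgroup.div_mem _ hf (Subgroup.zpow_mem _ hf₀ _)
  have hgval : g.val w₀ = f.val w₀ % a := by
    rw [hg, val_div, val_zpow, Int.emod_def]; ring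
  by_cases hg1 : g = 1
  · have : f = f₀ ^ q := by rwa [hg, div_eq_one] at hg1
    rw [this]; exact Subgroup.zpow_mem_zpowers _ _
  · exfalso
    have hlt : (g.val w₀).natAbs < a.natAbs := by
      rw [hgval]
      have h1 := Int.emod_nonneg (f.val w₀) ha0
      have h2 := Int.emod_lt_abs (f.val w₀) ha0
      rw [Int.abs_eq_natAbs] at h2
      omega
    exact absurd (hminimal g hgmem hg1) (not_le.mpr hlt)

/-- `#Ĥ⁻¹(G, K) = 1` for the relation lattice (torsion-free with trivial action: the norm is
`f ↦ f^n`, injective). [cite: Childress2009, Ch. 4 §5 Prop. 5.10 (proof) (PDF p. 101)] -/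
theorem h1_relLattice_eq_one [Fintype (E ≃ₐ[F] E)] (hu₂ : ∀ (σ : E ≃ₐ[F] E) (w : InfinitePlace E), σ • u w = u (σ • w))
    (σ : E ≃ₐ[F] E) : Herbrand.h1 σ (relLattice u) ⊥ = 1 := by
  have hz : Herbrand.z1 (E ≃ₐ[F] E) (relLattice u) ⊥ = ⊥ := by
    rw [eq_bot_iff]
    intro f hf
    obtain ⟨hfK, hN⟩ := Herbrand.mem_z1.mp hf
    rw [Subgroup.mem_bot] at hN ⊢
    rw [Herbrand.norm_eq_pow_card_of_forall_smul_eq (fun g => smul_eq_of_mem_relLattice hu₁ hu₂ hu₃ g hfK)] at hN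
    ext w
    have := congrArg (fun h : PermMod (InfinitePlace E) => h.val w) hN
    simp only [val_pow, val_one, mul_eq_zero, Nat.cast_eq_zero, Fintype.card_ne_zero, false_or] at this
    rw [this, val_one]
  rw [Herbrand.h1_def, hz, Subgroup.relIndex_bot_right]

/-- `#Ĥ⁰(G, K) = #G` for the non-trivial relation lattice (`K ≅ ℤ` with trivial action).
[cite: Childress2009, Ch. 4 §5 Prop. 5.10 (proof) (PDF p. 101)] -/
theorem h0_relLattice_eq_card [Fintype (E ≃ₐ[F] E)] (hu₂ : ∀ (σ : E ≃ₐ[F] E) (w : InfinitePlace E), σ • u w = u (σ • w))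
    (hK : relLattice u ≠ ⊥) (σ : E ≃ₐ[F] E) :
    Herbrand.h0 σ (relLattice u) ⊥ = Fintype.card (E ≃ₐ[F] E) := by
  classical
  obtain ⟨f₀, hf₀, hKeq⟩ := exists_relLattice_eq_zpowers hu₁ hu₃ hK
  have hz : Herbrand.z0 σ (relLattice u) ⊥ = relLattice u := by
    apply le_antisymm Herbrand.z0_le
    intro f hf
    exact Herbrand.mem_z0_bot.mpr ⟨hf, smul_eq_of_mem_relLattice hu₁ hu₂ hu₃ σ hf⟩
  have hb : Herbrand.b0 (E ≃ₐ[F] E) (relLattice u) ⊥ = Subgroup.zpowers (f₀ ^ Fintype.card (E ≃ₐ[F] E)) := by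
    rw [Herbrand.b0_bot]
    apply le_antisymm
    · rintro _ ⟨f, hf, rfl⟩
      rw [Herbrand.norm_eq_pow_card_of_forall_smul_eq (fun g => smul_eq_of_mem_relLattice hu₁ hu₂ hu₃ g hf)]
      rw [hKeq] at hf
      obtain ⟨k, rfl⟩ := Subgroup.mem_zpowers_iff.mp hf
      rw [show (f₀ ^ k) ^ Fintype.card (E ≃ₐ[F] E) = (f₀ ^ Fintype.card (E ≃ₐ[F] E)) ^ k by
        rw [← zpow_natCast, ← zpow_mul, ← zpow_natCast, ← zpow_mul, mul_comm]]
      exact Subgroup.zpow_mem_zpowers _ _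
    · rw [Subgroup.zpowers_le]
      have hf₀K : f₀ ∈ relLattice u := by rw [hKeq]; exact Subgroup.mem_zpowers _
      refine ⟨f₀, hf₀K, ?_⟩
      rw [Herbrand.norm_eq_pow_card_of_forall_smul_eq (fun g => smul_eq_of_mem_relLattice hu₁ hu₂ hu₃ g hf₀K)]
  rw [Herbrand.h0_def, hz, hb, hKeq]
  refine relIndex_zpowers_pow f₀ (fun k k' h => ?_) _
  obtain ⟨w₀, hw₀⟩ : ∃ w₀, f₀.val w₀ ≠ 0 := by
    by_contra h
    simp only [not_exists, not_not] at h
    exact hf₀ (PermMod.ext fun w => by rw [h w, val_one])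
  have := congrArg (fun f : PermMod (InfinitePlace E) => f.val w₀) h
  simp only [val_zpow] at this
  exact mul_right_cancel₀ hw₀ this

end Realisation

end MinkowskiUnit

end Literature.NumberTheory.GaloisRepresentations
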